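import Mathlib.Analysis.Calculus.IteratedDeriv.Lemmas
import Mathlib.Analysis.SpecialFunctions.ExpDeriv
import Mathlib.Analysis.SpecialFunctions.Exponential
import Mathlib.Analysis.SpecialFunctions.Log.Basic
import Mathlib.Analysis.SpecialFunctions.Trigonometric.Basic
import Mathlib.Topology.Algebra.Order.LiminfLimsup
import Summits.AtomisticToContinuum.FouriersLaw.Theorems.GreenKuboContinuation.Negative.RealVitaliUniformityTightness

/-!
# Crux `GreenKuboContinuation` (stmt-AtomisticToContinuum-12597), line `temperature-blind-vitali-hurwitz`:
# a `ν`-uniform analyticity RADIUS with a polynomially growing PREFACTOR does not transport existence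

Drefute seat (gen 2), sharper companion of `RealVitaliUniformityTightness.lean`. The modulus stub
`stub_logGevreyTower` of the picked line demands `|∂_T^k log A_T(ν)| ≤ C^{k+1} k!` with `C`
independent of `ν ∈ (0,1]` — i.e. BOTH a `ν`-uniform radius `1/C` AND a `ν`-uniform sup bound on the
complex neighbourhood. The natural output of a cluster / tree-graph expansion for an observable of
spatial support `∼ 1/ν` (the response field `j₀ R_ν` of the cards) is weaker: a uniform RATE with a
PREFACTOR polynomial in `ν⁻¹`, `|∂_T^k g_ν| ≤ ν^{-m} C^{k+1} k!`. This file proves that such a bound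
does NOT suffice for the Vitali step: `realVitali_false_with_polynomial_prefactor` — the statement of
`stub_realVitali` with H2 weakened to `∃ C m, ∀ ν k T, |∂_T^k g ν T| ≤ (ν⁻¹)^m C^{k+1} k!` is FALSE.
Witness (entire in `T`, uniform rate, prefactor `ν^{-(⌈b⌉+1)}` on `[a,b]`):
`g ν T := sin ν⁻¹ · ν^{2-T} = sin ν⁻¹ · e^{-2L} e^{LT}`, `L = log ν⁻¹ ≥ 0`, `T₀ = 1`:
`|g ν T| ≤ ν` on the corner `T < 1` (limit `0`), `g ν 2 = sin ν⁻¹` (no limit), and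
`|∂_T^k g ν T| = L^k e^{L(T-2)} |sin ν⁻¹| ≤ k! e^{L} · e^{L⌈b⌉} = (ν⁻¹)^{⌈b⌉+1} k!` (`L^k ≤ k! e^L`).
Consequence for the lead / the tower's prover: the prefactor, not only the radius, must be
`ν`-uniform. (Remark, not formalised: by the two-constants theorem a prefactor `ν^{-m}` could still be
tolerated if the corner convergence came with a RATE, `|g_ν - g_{ν'}| ≤ ν^{q}` on the seed interval
with `q θ(T) > m`, `θ(T) ∈ (0,1)` the harmonic measure of the seed interval seen from `T` in the
complex neighbourhood — but the crux hypothesis supplies bare convergence, no rate; the witness here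
converges on the corner exactly at rate `ν¹` and still fails at `T = 2`.)
Sorry-free; imports Mathlib and the landed sibling `RealVitaliUniformityTightness` (for
`not_tendsto_sin_inv`); axioms `propext`, `Classical.choice`, `Quot.sound`.
-/

noncomputable section

namespace Summit.AtomisticToContinuum.FouriersLaw.Theorems.GreenKuboContinuation.Negative

open Filter Topology Set

/-- Closed form of the `T`-derivatives of the exponential family `T ↦ (s · e^{-2r}) e^{rT}`:
`∂_T^k = r^k ×` itself. -/
theorem iteratedDeriv_expFamily (s r : ℝ) (k : ℕ) :
    iteratedDeriv k (fun T : ℝ => (s * Real.exp (-(2 * r))) * Real.exp (r * T)) =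
      fun T => (s * Real.exp (-(2 * r))) * (r ^ k * Real.exp (r * T)) := by
  funext T
  have h : (fun T : ℝ => (s * Real.exp (-(2 * r))) * Real.exp (r * T)) =
      fun T => (s * Real.exp (-(2 * r))) * (fun u => Real.exp (r * u)) T := rfl
  rw [h, iteratedDeriv_const_mul_field, iteratedDeriv_exp_const_mul]

/-- The exponential family is entire: all its `T`-derivatives are differentiable. -/
theorem differentiable_iteratedDeriv_expFamily (s r : ℝ) (k : ℕ) :
    Differentiable ℝ (iteratedDeriv k (fun T : ℝ => (s * Real.exp (-(2 * r))) * Real.exp (r * T))) := by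
  rw [iteratedDeriv_expFamily]
  fun_prop

/-- The POLYNOMIAL-PREFACTOR factorial bound for the witness `g ν T = sin ν⁻¹ · ν^{2-T}`
(`r = L = log ν⁻¹`): on `[a,b]`, `|∂_T^k g ν| ≤ (ν⁻¹)^{⌈b⌉₊+1} · 1^{k+1} · k!` for `0 < ν ≤ 1`. -/
theorem abs_iteratedDeriv_logFamily_le {ν a b : ℝ} (hν : 0 < ν) (hν1 : ν ≤ 1) (k : ℕ) {T : ℝ}
    (hT : T ∈ Icc a b) :
    |iteratedDeriv k (fun T : ℝ => (Real.sin ν⁻¹ * Real.exp (-(2 * Real.log ν⁻¹))) *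
        Real.exp (Real.log ν⁻¹ * T)) T| ≤
      (ν⁻¹) ^ (⌈b⌉₊ + 1) * ((1 : ℝ) ^ (k + 1) * (k.factorial : ℝ)) := by
  set L := Real.log ν⁻¹ with hLdef
  have hinv : 1 ≤ ν⁻¹ := one_le_inv_iff₀.2 ⟨hν, hν1⟩
  have hL : 0 ≤ L := Real.log_nonneg hinv
  have hexpL : Real.exp L = ν⁻¹ := by rw [hLdef, Real.exp_log (inv_pos.2 hν)]
  rw [iteratedDeriv_expFamily]
  simp only [one_pow, one_mul]
  -- |sin ν⁻¹ · e^{-2L} · (L^k e^{LT})| = |sin| · L^k · e^{L(T-2)}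
  have hs : |Real.sin ν⁻¹| ≤ 1 := Real.abs_sin_le_one _
  have hLk : L ^ k ≤ (k.factorial : ℝ) * Real.exp L := by
    -- `L^k / k! ≤ e^L` (Mathlib `Real.pow_div_factorial_le_exp`)
    have h := Real.pow_div_factorial_le_exp L hL k
    have hk : (0 : ℝ) < (k.factorial : ℝ) := by exact_mod_cast k.factorial_pos
    rw [div_le_iff₀ hk] at h
    linarith [mul_comm (Real.exp L) (k.factorial : ℝ)]
  -- e^{-2L} e^{LT} = e^{L(T-2)} ≤ e^{L ⌈b⌉₊}
  have hTb : T - 2 ≤ (⌈b⌉₊ : ℝ) := by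
    have := Nat.le_ceil b
    linarith [hT.2]
  have hexp2 : Real.exp (-(2 * L)) * Real.exp (L * T) ≤ Real.exp L ^ ⌈b⌉₊ := by
    rw [← Real.exp_add, ← Real.exp_nat_mul]
    exact Real.exp_le_exp.2 (by nlinarith)
  have hfact : (0 : ℝ) ≤ (k.factorial : ℝ) := Nat.cast_nonneg _
  calc |Real.sin ν⁻¹ * Real.exp (-(2 * L)) * (L ^ k * Real.exp (L * T))|
        = |Real.sin ν⁻¹| * (L ^ k * (Real.exp (-(2 * L)) * Real.exp (L * T))) := by
          rw [abs_mul, abs_mul, abs_mul, abs_of_pos (Real.exp_pos _), abs_of_pos (Real.exp_pos _),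
            abs_of_nonneg (pow_nonneg hL k)]
          ring
    _ ≤ 1 * (((k.factorial : ℝ) * Real.exp L) * Real.exp L ^ ⌈b⌉₊) := by
          refine mul_le_mul hs ?_ (by positivity) zero_le_one
          exact mul_le_mul hLk hexp2 (by positivity) (by positivity)
    _ = (ν⁻¹) ^ (⌈b⌉₊ + 1) * (k.factorial : ℝ) := by rw [hexpL]; ring

/-- On the corner side `T < 1` the witness is bounded by `ν` in absolute value (for `ν < 1`), hence
tends to `0` as `ν ↓ 0`. -/
theorem tendsto_logFamily_of_lt_one {T : ℝ} (hT : T < 1) :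
    Tendsto (fun ν : ℝ => (Real.sin ν⁻¹ * Real.exp (-(2 * Real.log ν⁻¹))) *
      Real.exp (Real.log ν⁻¹ * T)) (𝓝[>] 0) (𝓝 0) := by
  have hid : Tendsto (fun ν : ℝ => ν) (𝓝[>] (0:ℝ)) (𝓝 0) :=
    (tendsto_id (x := 𝓝 (0:ℝ))).mono_left nhdsWithin_le_nhds
  refine squeeze_zero_norm' ?_ hid
  filter_upwards [Ioo_mem_nhdsGT (zero_lt_one' ℝ)] with ν hν
  have hν' : 0 < ν := hν.1
  have hL : 0 ≤ Real.log ν⁻¹ := Real.log_nonneg (one_le_inv_iff₀.2 ⟨hν', hν.2.le⟩)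
  rw [Real.norm_eq_abs, abs_mul, abs_mul, abs_of_pos (Real.exp_pos _), abs_of_pos (Real.exp_pos _),
    mul_assoc, ← Real.exp_add]
  have hle : -(2 * Real.log ν⁻¹) + Real.log ν⁻¹ * T ≤ -Real.log ν⁻¹ := by nlinarith
  have hexp : Real.exp (-(2 * Real.log ν⁻¹) + Real.log ν⁻¹ * T) ≤ ν := by
    calc Real.exp (-(2 * Real.log ν⁻¹) + Real.log ν⁻¹ * T) ≤ Real.exp (-Real.log ν⁻¹) :=
          Real.exp_le_exp.2 hle
      _ = ν := by rw [Real.log_inv, neg_neg, Real.exp_log hν']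
  calc |Real.sin ν⁻¹| * Real.exp (-(2 * Real.log ν⁻¹) + Real.log ν⁻¹ * T) ≤ 1 * ν :=
        mul_le_mul (Real.abs_sin_le_one _) hexp (Real.exp_pos _).le zero_le_one
    _ = ν := one_mul ν

/-- At `T = 2` the witness is `sin ν⁻¹`. -/
theorem logFamily_two (ν : ℝ) :
    (Real.sin ν⁻¹ * Real.exp (-(2 * Real.log ν⁻¹))) * Real.exp (Real.log ν⁻¹ * 2) = Real.sin ν⁻¹ := by
  rw [mul_assoc, ← Real.exp_add]
  have : -(2 * Real.log ν⁻¹) + Real.log ν⁻¹ * 2 = 0 := by ring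
  rw [this, Real.exp_zero, mul_one]

/-- **`stub_realVitali` IS FALSE WITH A POLYNOMIAL PREFACTOR** — a `ν`-uniform analyticity radius
is not enough, the sup bound must be `ν`-uniform too: the statement of `stub_realVitali` with H2
weakened to `∃ C m, ∀ ν ∈ (0,1], ∀ k ≥ 1, ∀ T ∈ [a,b], |∂_T^k g ν T| ≤ (ν⁻¹)^m · C^{k+1} k!`
(rate `C` still UNIFORM in `ν`; only the prefactor grows, polynomially) is refuted by the entire
family `g ν T = sin ν⁻¹ · ν^{2-T}` (`T₀ = 1`, failure at `T = 2`, `C = 1`, `m = ⌈b⌉₊ + 1`). -/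
theorem realVitali_false_with_polynomial_prefactor :
    ¬ (∀ (g : ℝ → ℝ → ℝ) (T₀ : ℝ), 0 < T₀ →
      (∀ ν : ℝ, 0 < ν → ν ≤ 1 → ∀ k : ℕ, DifferentiableOn ℝ (iteratedDeriv k (g ν)) (Set.Ioi 0)) →
      (∀ a b : ℝ, 0 < a → a < b → ∃ (C : ℝ) (m : ℕ), 0 < C ∧ ∀ ν : ℝ, 0 < ν → ν ≤ 1 →
        ∀ k : ℕ, 1 ≤ k → ∀ T ∈ Set.Icc a b,
          |iteratedDeriv k (g ν) T| ≤ (ν⁻¹) ^ m * (C ^ (k + 1) * (k.factorial : ℝ))) →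
      (∀ T : ℝ, 0 < T → T < T₀ →
        ∃ L : ℝ, Filter.Tendsto (fun ν : ℝ => g ν T) (nhdsWithin (0:ℝ) (Set.Ioi 0)) (nhds L)) →
      ∀ T : ℝ, 0 < T →
        ∃ L : ℝ, Filter.Tendsto (fun ν : ℝ => g ν T) (nhdsWithin (0:ℝ) (Set.Ioi 0)) (nhds L)) := by
  intro h
  have hs : ∀ ν : ℝ, 0 < ν → ν ≤ 1 → ∀ k : ℕ,
      DifferentiableOn ℝ (iteratedDeriv k (fun T : ℝ => (Real.sin ν⁻¹ *
        Real.exp (-(2 * Real.log ν⁻¹))) * Real.exp (Real.log ν⁻¹ * T))) (Set.Ioi 0) :=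
    fun ν _ _ k => (differentiable_iteratedDeriv_expFamily _ _ k).differentiableOn
  have hb : ∀ a b : ℝ, 0 < a → a < b → ∃ (C : ℝ) (m : ℕ), 0 < C ∧ ∀ ν : ℝ, 0 < ν → ν ≤ 1 →
      ∀ k : ℕ, 1 ≤ k → ∀ T ∈ Set.Icc a b,
        |iteratedDeriv k (fun T : ℝ => (Real.sin ν⁻¹ * Real.exp (-(2 * Real.log ν⁻¹))) *
          Real.exp (Real.log ν⁻¹ * T)) T| ≤ (ν⁻¹) ^ m * (C ^ (k + 1) * (k.factorial : ℝ)) := by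
    intro a b _ _
    exact ⟨1, ⌈b⌉₊ + 1, one_pos, fun ν hν hν1 k _ T hT => abs_iteratedDeriv_logFamily_le hν hν1 k hT⟩
  have hc : ∀ T : ℝ, 0 < T → T < 1 →
      ∃ L : ℝ, Tendsto (fun ν : ℝ => (Real.sin ν⁻¹ * Real.exp (-(2 * Real.log ν⁻¹))) *
        Real.exp (Real.log ν⁻¹ * T)) (𝓝[>] 0) (𝓝 L) :=
    fun T _ hT1 => ⟨0, tendsto_logFamily_of_lt_one hT1⟩
  obtain ⟨L, hL⟩ := h (fun ν T => (Real.sin ν⁻¹ * Real.exp (-(2 * Real.log ν⁻¹))) *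
      Real.exp (Real.log ν⁻¹ * T)) 1 one_pos hs hb hc 2 two_pos
  simp only [logFamily_two] at hL
  exact not_tendsto_sin_inv ⟨L, hL⟩

end Summit.AtomisticToContinuum.FouriersLaw.Theorems.GreenKuboContinuation.Negative

end
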